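import Summits.CriticalPhenomena.PercolationContinuityZ3.Theorems.PercLowPointHalfSpaceTallClusterMassBoundStubMassLeTypicalMaxLog
import Summits.CriticalPhenomena.PercolationContinuityZ3.Theorems.PercLowPointHalfSpaceTallClusterMassBoundStubTightnessArithmetic

/-!
# `TallClusterMassBound` (stmt-CriticalPhenomena-0912), line `SketchIdeator4` (universal tightness):
# ARROW 1 assembled — the crux B follows from the typical-max residual C⁺

Glue of the line (crux `…Theses.PercLowPointHalfSpace.TallClusterMassBound`, item B of route PercLowPointHalfSpace),
sorry-free, hypotheses explicit:

* `tallClusterMassBound_of_halfBoxTypicalMax` : C⁺ → B, where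
  C⁺ = `∃ s < 11/4, ∃ C, ∀ r ≥ 1, typicalMax (floorDilutedPercolation 3 p_c 1) (halfBox r) ≤ C r^s` (the typical value of the
  largest cluster volume of bond percolation on the INDUCED half-space inside the half-box `Λ_r = B_r ∩ ℍ` grows with an
  exponent `< 11/4`; registered open stub `stub_halfBoxTypicalMax` of the skeleton `Cruxes/TallClusterMassBound/Lines/SketchIdeator4.lean`).
  Composition of the landed stubs `stub_massLeTypicalMaxLog` (ARROW 1 core: rooted universal tightness + layer cake,
  `M(r) ≤ K · typicalMax · π_s(r) · (1 + log(1/π_s(r)))`) and `stub_tightnessArithmetic` (`π_s(r) ≥ 1/(588 r²)`,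
  `r^s log r ≤ C_s r^{11/4}`).
Nothing here asserts C⁺; the crux stays open (closed modulo C⁺).
-/

noncomputable section

open MeasureTheory Finset Filter
open Literature.Probability.Percolation Literature.Probability.LatticeModels
open Summit.CriticalPhenomena.PercolationContinuityZ3.Theses.PercLowPointHalfSpace (TallClusterMassBound)
open Summit.CriticalPhenomena.PercolationContinuityZ3.Theorems.TallClusterMassBound.Negative

namespace Summit.CriticalPhenomena.PercolationContinuityZ3.Theorems.TallClusterMassBound.TightnessLine

/-- **B ⟸ C⁺ (ARROW 1 of line `SketchIdeator4`, assembled).** If the typical largest induced-half-space cluster volume in the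
half-box satisfies `typicalMax P^ℍ_{p_c} Λ_r ≤ C r^s` for some `s < 11/4`, then `TallClusterMassBound` holds. [folklore] -/
theorem tallClusterMassBound_of_halfBoxTypicalMax :
    (∃ s : ℝ, s < (11 : ℝ) / 4 ∧ ∃ C : ℝ, ∀ r : ℕ, 1 ≤ r →
      (typicalMax (floorDilutedPercolation 3 (criticalProbI 3) 1) (halfBox r) : ℝ) ≤ C * (r : ℝ) ^ s) →
    TallClusterMassBound := by
  intro h
  obtain ⟨K, hK⟩ := stub_massLeTypicalMaxLog
  obtain ⟨s, hs, C, hC⟩ := h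
  exact tallClusterMassBound_iff.2 (stub_tightnessArithmetic K s C hs hK hC)

end Summit.CriticalPhenomena.PercolationContinuityZ3.Theorems.TallClusterMassBound.TightnessLine
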